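import Mathlib
import HarnessLib
import Literature.NumberTheory.LFunctions.SuzukiSingleOperatorKernelProofs
import Summits.RiemannHypothesis.RiemannHypothesis.Theses.SuzukiWindowsDoor

/-!
# RiemannHypothesis / SuzukiWindowsDoor — support item `KernelContinuous` (stmt-RiemannHypothesis-19734) PROVED

RH-FREE KNOWN ([Su20] = Suzuki, ASPM 84 (2020), arXiv:1907.07302, Thm 1.2 (K-ii)): for every `θ > 10` Suzuki's
single kernel `K_θ` is continuous on `ℝ` — one line from the tree theorem
`Literature.NumberTheory.LFunctions.Suzuki2020_thm12_continuous` (proved for all `θ > 1`, rh-columns-lit g2,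
p408554); the route decl's inlined `K` is `limKernel θ` by `rfl`. Closer offered farm-verified by planner
rh-dbr-theory g5 (`ports/SuzukiWindowsDoorKernelContinuous.scratch.lean`). Nothing here bears on the truth of RH.
-/

noncomputable section

-- D-0017: `Summit.<S>.<S>.…` is the designed namespace of a single-problem summit.
set_option linter.dupNamespace false

namespace Summit.RiemannHypothesis.RiemannHypothesis.Theorems

/-- **Route `SuzukiWindowsDoor`, support item `KernelContinuous` (stmt-RiemannHypothesis-19734) — PROVED (RH-FREE).**
For every `θ > 10`, `K_θ` is continuous ([Su20] Thm 1.2 (K-ii); tree theorem for all `θ > 1`). -/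
theorem suzukiWindowsDoor_kernelContinuous_proof :
    Summit.RiemannHypothesis.RiemannHypothesis.Theses.SuzukiWindowsDoor.KernelContinuous := by
  intro θ hθ
  exact Literature.NumberTheory.LFunctions.Suzuki2020_thm12_continuous (θ := θ) (by linarith)

end Summit.RiemannHypothesis.RiemannHypothesis.Theorems

end
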